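import Summits.HodgeConjecture.HodgeConjecture.Theorems.Ring2AbelianAllWeilAnchorCellsOnPath
import Summits.HodgeConjecture.HodgeConjecture.Theorems.WeilTypeLadderBlochSeed
import HarnessLib

/-!
# Ring 2 · AbelianAll (ab-weil-1, gen 12, part 10) — the door-B cell node FED BY A BLOCH SEED: one integral
  Bloch-semiregular local complete intersection on ONE member of the cell, modulo Bloch's REFEREED theorem

research route, not a corollary; conditional on HC_CM plus one named minimal statement.
Cell line: research route conditional on HC_CM; not a corollary; Q11.4-sentence-2 already refuted in dim ≥ 3.
`HC_CM` (`Theses.RankFourFaces.CMAbelianHodge`) does not occur in this file and no open case of the Hodge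
conjecture is claimed.

## What is PROVED here (0 sorry)

Parts 8g/8h/9 reduced every Weil cell `(n, d, δ)` (`WeilClassesComponent n d δ`: all Weil classes of every
polarized `√-d`-Weil `2n`-fold of discriminant class `δ ∈ ℚ^×/Nm(K^×)` are algebraic) to Deligne's REFEREED
reach-by-similitude `weilFamilyReach_similar` plus ONE locally algebraic anchor in the cell,
`HasLocallyAlgebraicWeilAnchorInClass n d δ` — whose open half is the family-quantified deformation clause
`WeilAnchorLocalClause` at that anchor.  The b2b seat `hweil` has meanwhile typed the REFEREED deformation theorem
that discharges such a clause from an OBJECT on the anchor: Bloch's semiregularity theorem in class-level form,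
the named fact `BlochSemiregularSpread (2n) n` (Bloch 1972 Thm. (7.4) / Remark (7.5) = Buchweitz–Flenner 2003
Thm. 5.2 at `I = {n}` = Voisin, LNM 1594, L7 Thm. 2.4; `Literature/…/BlochSemiregularSpread.lean`), with the object
predicate `HasBlochSeedAt n P h w` (an INTEGRAL closed regular immersion `Z ↪ P` of codimension `n`,
Bloch-semiregular, with `q·hⁿ + w` supported on `Z`) and the proved bridge
`weilAnchorLocalClause_of_blochSpread_of_blochSeedAt` (`Literature/…/WeilClassesBlochSeed.lean`).  This file
re-types the per-cell find-the-cycle target through that door.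

* §1 THE NODE `HasBlochSeedInClass n d δ`: IF the cell is realisable (`sign δ = (-1)ⁿ`) THEN some member
  `(P, ψ₀, h_K = d·e^*a + ψ₀^*e^*a)` of discriminant class `δ` carries a non-zero rational Weil class `w` and a
  Bloch seed for `q·h_Kⁿ + w`.  `hasBlochSeedInClass_of_member` / `_of_subscheme` file a found seed.
* §2 `HasBlochSeedInClass n d δ ∧ BlochSemiregularSpread (2n) n ⟹ HasLocallyAlgebraicWeilAnchorInClass n d δ`
  (hweil's bridge, pointwise), hence
  **`weilFamilyReach_similar ∧ BlochSemiregularSpread (2n) n ∧ HasBlochSeedInClass n d δ ⟹ WeilClassesComponent n d δ`**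
  — the cell from TWO REFEREED PRINT THEOREMS and ONE OBJECT on ONE variety — and the variational / anchored halves
  of the record residual (part 9 §3).
* §3 CONCORDANCE with hweil (count once): the split cell is hweil's hyperbolic seed,
  `HasBlochSeedInClass n d [(-1)ⁿ] ↔ HasHyperbolicBlochSeed n d` (van Geemen 5.4), and seeds in every class give
  hweil's door-B′ input, `(∀ δ, HasBlochSeedInClass n d δ) → HasSimilarBlochSeeds n d` (Landherr: same class ⟹
  Weil-similar, part 8g §1); so stmt-2524 ⟸ reach ∧ Bloch(6,3) ∧ seeds in the sixfold cells is hweil's row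
  `weilSixfolds_of_reachSimilar_of_blochSpread_of_similarSeeds` re-indexed by cells (finitely many classes of the
  right sign per `d` instead of "every target").
* §4 CLOSED FORMS `HasBlochSeedFourfoldCells` / `HasBlochSeedAllCells` and THE FLOOR:
  `HC` in dimension `≤ 5` ⟸ the four refereed print facts ∧ `weilFamilyReach_similar` ∧ `BlochSemiregularSpread 4 2`
  ∧ one Bloch-semiregular integral lci SURFACE carrying `q·h_K² + w` on one member of each positive non-split
  squarefree-`d` fourfold cell.
* §5 NECESSITY, unconditionally (Fulton 19.1.1 in the tree, `iSup_classesSupportedOn_le_algebraicClasses`): a Bloch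
  seed makes `q·hⁿ + w`, hence (Lefschetz (1,1) + Kleiman on the abelian `P`) `w`, ALGEBRAIC ON `P` — a seed member is
  a member with algebraic Weil classes (met by every CM member, part 8b) PLUS an integral semiregular support.

ON-PATH STATUS (cell rule "every node a consequence of the summit").  The fact is on path
(`WeilTypeLadder.blochSemiregularSpread_of_hodgeConjecture`, hweil).  The seed node is NOT: like hweil's
`HasHyperbolicBlochSeed` / `HasSimilarBlochSeeds` it is a DESIGN input (Bloch, Remark (7.5): semiregular
representatives in codimension `> 1` are "wide open") and no lemma `HodgeConjecture → HasBlochSeedInClass` is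
claimed; the on-path node of the cell remains `HasLocallyAlgebraicWeilAnchorInClass` (part 9 §1), which the seed
node FEEDS (§2).  What a seed may NOT be (hweil's census, module docstrings of `WeilClassesBlochSeed.lean`,
`WeilClassesTensorBlochSeed.lean`, `WeilClassTestSplitDesigns.lean`): a single sub-torus, a gallery, a disconnected
union, a complete intersection of divisors, a split design at a tensor point; `Z` must be INTEGRAL.

Nothing here is new mathematics: §1–§4 are bookkeeping on the carriers over hweil's bridge; §5 is Fulton 19.1.1 /
Lefschetz (1,1) as landed. [cite: Bloch1972Semiregularity, Thm. (7.4) and Remark (7.5)]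
[cite: BuchweitzFlenner2003, Thm. 5.2] [cite: Deligne1982HodgeCycles, proof of Thm. 4.8]
[cite: vanGeemen1994HodgeAV, 4.14, Lemma 5.2 and 5.4] [cite: Fulton1998, Lemma 19.1.1]

## References

* [Bloch1972Semiregularity] S. Bloch, Semi-regularity and de Rham cohomology, Invent. Math. 17 (1972), Thm. (7.4),
  Remark (7.5).
* [BuchweitzFlenner2003] R.-O. Buchweitz, H. Flenner, Compositio Math. 137 (2003), Thm. 5.2.
* [VoisinTorino1994] C. Voisin, LNM 1594, Lecture 7, Thm. 2.4.
* [Deligne1982HodgeCycles] P. Deligne, LNM 900 (1982), Prop. 4.4, proof of Thm. 4.8 (pp. 47–52).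
* [vanGeemen1994HodgeAV] B. van Geemen, LNM 1594 (1994), 4.14, Lemma 5.2, Thm. 5.3, 5.4, Thm. 6.12.
* [Fulton1998] W. Fulton, Intersection Theory, 2nd ed., Lemma 19.1.1.
* [MoonenZarhin1999] B. Moonen, Yu. Zarhin, Thm. 0.1.
* [Landherr1936HermitianForms] W. Landherr, Abh. Math. Sem. Hamburg 11 (1936).
-/

set_option linter.dupNamespace false

noncomputable section

open CategoryTheory AlgebraicGeometry
open Literature.AlgebraicGeometry Literature.AlgebraicGeometry.Motives
open Literature.AlgebraicGeometry.HodgeTheory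
open Literature.AlgebraicGeometry.VanGeemen1994
open Literature.AlgebraicTopology.SingularHomology
open Summit.HodgeConjecture.HodgeConjecture.Ring2.Hypotheses
open Summit.HodgeConjecture.HodgeConjecture.Theorems.HyperbolicEightfoldsSqrtMinus7.AnchorObject
  (cupPowTwo_mem_algebraicClasses_abelian)

namespace Summit.HodgeConjecture.HodgeConjecture.Ring2.AbelianAll

/-! ### §1 The node: one Bloch seed in the cell -/

/-- **`HasBlochSeedInClass n d δ`** (N80; a DESIGN input, nothing asserted, no on-path lemma) — IF the cell
`(n, d, δ)` is realisable (`sign δ = (-1)ⁿ`, van Geemen 4.14) THEN it contains a polarized member: an abelian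
`2n`-fold `(P, ψ₀)` with `ψ₀² = -d`, a projective embedding `e` and a non-zero rational `a ∈ H²(ℙ; ℂ)` — giving the
`K`-symmetrised hyperplane class `h_K := d·e^*a + ψ₀^*e^*a` — whose Gram discriminant class is `δ`, together with a
non-zero rational Weil class `w` of Hodge type `(n, n)` and a BLOCH SEED for `q·h_Kⁿ + w` (`HasBlochSeedAt`: an
integral closed regular immersion `Z ↪ P` of codimension `n`, Bloch-semiregular, `q ∈ ℚ`, `q·h_Kⁿ + w` supported on
`Z`; Bloch, Remark (7.5), for `z₀ = w`, `l₀ = h_K`). [cite: Bloch1972Semiregularity, Thm. (7.4) and Remark (7.5)]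
[cite: vanGeemen1994HodgeAV, 4.14 and Lemma 5.2] [cite: Deligne1982HodgeCycles, proof of Thm. 4.8] -/
@[conjecture] def HasBlochSeedInClass (n d : ℕ) (δ : weilNormResidueGroup d) : Prop :=
  weilSign d δ = (-1) ^ n →
  ∃ (P : AbelianVariety ℂ) (ψ₀ : P ⟶ P) (e : ProjectiveEmbedding P.X) (a : complexBetti (projectiveSpace e.n ℂ) 2)
    (w : complexBetti P.X (2 * n)),
    P.dim = 2 * n ∧ ψ₀ ≫ ψ₀ = -(d • 𝟙 P) ∧ IsRationalClass a ∧ a ≠ 0 ∧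
    w ∈ weilClassesOf P ψ₀ n d ∧ IsRationalClass w ∧ w ≠ 0 ∧ IsOfHodgeType (2 * n) P.X (2 * n) n n w ∧
    HasBlochSeedAt n P
      ((d : ℂ) • complexBetti.map e.ι 2 a + complexBetti.map ψ₀.hom.hom.hom 2 (complexBetti.map e.ι 2 a)) w ∧
    HasWeilDiscriminantNondeg P ψ₀ n d
      ((d : ℂ) • complexBetti.map e.ι 2 a + complexBetti.map ψ₀.hom.hom.hom 2 (complexBetti.map e.ι 2 a)) δ

/-- **Filing a found seed**: a Weil-type member `(P, ψ₀, h_K)` of discriminant class `δ`, a non-zero rational Weil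
class `w` on it and a Bloch seed for `q·h_Kⁿ + w` give `HasBlochSeedInClass n d δ` (the Hodge type of `w` is
automatic, van Geemen 5.2 (1)). [cite: vanGeemen1994HodgeAV, Lemma 5.2 (1)] [cite: Bloch1972Semiregularity, Remark (7.5)] -/
theorem hasBlochSeedInClass_of_member {P : AbelianVariety ℂ} {ψ₀ : P ⟶ P} {n d : ℕ}
    (hW : IsWeilType P ψ₀ n d) (e : ProjectiveEmbedding P.X) {a : complexBetti (projectiveSpace e.n ℂ) 2}
    (haQ : IsRationalClass a) (ha0 : a ≠ 0) {δ : weilNormResidueGroup d}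
    (hδ : HasWeilDiscriminantNondeg P ψ₀ n d
      ((d : ℂ) • complexBetti.map e.ι 2 a + complexBetti.map ψ₀.hom.hom.hom 2 (complexBetti.map e.ι 2 a)) δ)
    {w : complexBetti P.X (2 * n)} (hwW : w ∈ weilClassesOf P ψ₀ n d) (hwQ : IsRationalClass w) (hw0 : w ≠ 0)
    (hseed : HasBlochSeedAt n P
      ((d : ℂ) • complexBetti.map e.ι 2 a + complexBetti.map ψ₀.hom.hom.hom 2 (complexBetti.map e.ι 2 a)) w) :
    HasBlochSeedInClass n d δ :=
  fun _ => ⟨P, ψ₀, e, a, w, hW.dim_eq, hW.sq_eq, haQ, ha0, hwW, hwQ, hw0, hW.isOfHodgeType_of_mem_weilClassesOf hwW,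
    hseed, hδ⟩

/-- **Filing a found seed, in primitive terms** (the search target spelled out for the cycle-finder): the subscheme
`Z`, its closed immersion `i : Z ↪ P`, regular of codimension `n`, `Z` integral of codimension `≥ n` pointwise,
Bloch-semiregular (`H¹(Z, 𝒩_{Z/P}) → H^{n+1}(P, Ω^{n-1}_P)` injective), and `q ∈ ℚ` with `q·h_Kⁿ + w` supported on
`Z`. [cite: Bloch1972Semiregularity, Thm. (7.4) and Remark (7.5)] [cite: BuchweitzFlenner2003, Thm. 5.2] -/
theorem hasBlochSeedInClass_of_subscheme {P : AbelianVariety ℂ} {ψ₀ : P ⟶ P} {n d : ℕ}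
    (hW : IsWeilType P ψ₀ n d) (e : ProjectiveEmbedding P.X) {a : complexBetti (projectiveSpace e.n ℂ) 2}
    (haQ : IsRationalClass a) (ha0 : a ≠ 0) {δ : weilNormResidueGroup d}
    (hδ : HasWeilDiscriminantNondeg P ψ₀ n d
      ((d : ℂ) • complexBetti.map e.ι 2 a + complexBetti.map ψ₀.hom.hom.hom 2 (complexBetti.map e.ι 2 a)) δ)
    {w : complexBetti P.X (2 * n)} (hwW : w ∈ weilClassesOf P ψ₀ n d) (hwQ : IsRationalClass w) (hw0 : w ≠ 0)
    (Z : Scheme.{0}) (i : Z ⟶ P.X.left) (q : ℚ) (hci : IsClosedImmersion i) (hreg : IsRegularImmersionOfCodim i n)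
    (hint : AlgebraicGeometry.IsIntegral Z) (hcod : ∀ z ∈ Set.range i.base, (n : ℕ∞) ≤ Order.coheight z)
    (hsr : IsBlochSemiregular i (2 * n) n)
    (hsupp : ((q : ℚ) : ℂ) •
        cupPowTwo ((d : ℂ) • complexBetti.map e.ι 2 a + complexBetti.map ψ₀.hom.hom.hom 2 (complexBetti.map e.ι 2 a)) n
        + w ∈ classesSupportedOn P.X (Set.range i.base) (2 * n)) :
    HasBlochSeedInClass n d δ :=
  hasBlochSeedInClass_of_member hW e haQ ha0 hδ hwW hwQ hw0 ⟨Z, i, q, hci, hreg, hint, hcod, hsr, hsupp⟩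

/-! ### §2 Seed ∧ Bloch's theorem ⟹ the door-B anchor ⟹ the cell -/

/-- **N80 ∧ `BlochSemiregularSpread (2n) n` ⟹ N77.** A Bloch seed in the cell is a locally algebraic anchor in the
cell, by hweil's bridge `weilAnchorLocalClause_of_blochSpread_of_blochSeedAt` (Bloch's theorem transported along any
reach family through the anchor). [cite: Bloch1972Semiregularity, Thm. (7.4)] [cite: BuchweitzFlenner2003, Thm. 5.2] -/
theorem hasLocallyAlgebraicWeilAnchorInClass_of_blochSpread_of_seedInClass {n d : ℕ} {δ : weilNormResidueGroup d}
    (hB : BlochSemiregularSpread (2 * n) n) (hS : HasBlochSeedInClass n d δ) :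
    HasLocallyAlgebraicWeilAnchorInClass n d δ := fun hsgn => by
  obtain ⟨P, ψ₀, e, a, w, hP, hψ, ha, ha0, hwW, hwQ, hw0, hwH, hseed, hδ⟩ := hS hsgn
  exact ⟨P, ψ₀, e, a, w, hP, hψ, ha, ha0, hwW, hwQ, hw0, hwH,
    weilAnchorLocalClause_of_blochSpread_of_blochSeedAt d hB hseed, hδ⟩

/-- **THE CELL FROM TWO REFEREED THEOREMS AND ONE OBJECT**: `weilFamilyReach_similar` (Deligne, proof of 4.8) ∧
`BlochSemiregularSpread (2n) n` (Bloch (7.4)) ∧ `HasBlochSeedInClass n d δ` ⟹ `WeilClassesComponent n d δ`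
(`n, d ≥ 1`). [cite: Deligne1982HodgeCycles, proof of Thm. 4.8] [cite: Bloch1972Semiregularity, Thm. (7.4)]
[cite: vanGeemen1994HodgeAV, Lemma 5.2 and Thm. 5.3] -/
theorem weilClassesComponent_of_reachSimilar_of_blochSpread_of_seedInClass {n d : ℕ} {δ : weilNormResidueGroup d}
    (hF : weilFamilyReach_similar) (hn : 0 < n) (hd : 0 < d) (hB : BlochSemiregularSpread (2 * n) n)
    (hS : HasBlochSeedInClass n d δ) : WeilClassesComponent n d δ :=
  weilClassesComponent_of_reachSimilar_of_anchorInClass hF hn hd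
    (hasLocallyAlgebraicWeilAnchorInClass_of_blochSpread_of_seedInClass hB hS)

/-- **… hence the variational half of the record residual**, `WeilVariationalHodgeComponent n d δ` (part 9 §3).
[cite: Deligne1982HodgeCycles, proof of Thm. 4.8] [cite: Bloch1972Semiregularity, Thm. (7.4)] -/
theorem weilVariationalHodgeComponent_of_reachSimilar_of_blochSpread_of_seedInClass {n d : ℕ}
    {δ : weilNormResidueGroup d} (hF : weilFamilyReach_similar) (hn : 0 < n) (hd : 0 < d)
    (hB : BlochSemiregularSpread (2 * n) n) (hS : HasBlochSeedInClass n d δ) :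
    WeilVariationalHodgeComponent n d δ :=
  weilVariationalHodgeComponent_of_weilClassesComponent
    (weilClassesComponent_of_reachSimilar_of_blochSpread_of_seedInClass hF hn hd hB hS)

/-- **… and the anchored half**, `AnchoredWeilFamiliesComponent n d δ` (part 9 §3).
[cite: Deligne1982HodgeCycles, proof of Thm. 4.8] [cite: Bloch1972Semiregularity, Thm. (7.4)] -/
theorem anchoredWeilFamiliesComponent_of_reachSimilar_of_blochSpread_of_seedInClass {n d : ℕ}
    {δ : weilNormResidueGroup d} (hF : weilFamilyReach_similar) (hn : 0 < n) (hd : 0 < d)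
    (hB : BlochSemiregularSpread (2 * n) n) (hS : HasBlochSeedInClass n d δ) :
    AnchoredWeilFamiliesComponent n d δ :=
  anchoredWeilFamiliesComponent_of_weilClassesComponent
    (weilClassesComponent_of_reachSimilar_of_blochSpread_of_seedInClass hF hn hd hB hS)

/-! ### §3 Concordance with hweil's seed predicates (count once) -/

/-- **Split cell ⟹ hweil's hyperbolic seed**: a seed member of the cell `(n, d, [(-1)ⁿ])` is hyperbolic for `h_K`
(van Geemen (5.4.1) ⟸, `isHyperbolicWeilType_of_hasWeilDiscriminantNondeg_split`). [cite: vanGeemen1994HodgeAV, 5.4] -/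
theorem hasHyperbolicBlochSeed_of_seedInClass_split {n d : ℕ} (hn : 0 < n) (hd : 0 < d)
    (h : HasBlochSeedInClass n d (splitDiscriminantClass n d)) : HasHyperbolicBlochSeed n d := by
  obtain ⟨P, ψ₀, e, a, w, hP, hψ, ha, ha0, hwW, hwQ, hw0, hwH, hseed, hδ⟩ := h (weilSign_splitDiscriminantClass n d)
  exact ⟨P, ψ₀, e, a, w, hP, hψ, ha, ha0,
    isHyperbolicWeilType_of_hasWeilDiscriminantNondeg_split hn hP hd hψ e ha ha0 ⟨w, hwW, hwQ, hwH, hw0⟩ hδ,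
    hwW, hwQ, hw0, hseed⟩

/-- **hweil's hyperbolic seed ⟹ split cell**: a hyperbolic seed anchor lies in the class `[(-1)ⁿ]`
(van Geemen (5.4.1) ⟹, `hasWeilDiscriminantNondeg_neg_one_pow_of_isHyperbolicWeilType`) and its Weil class has Hodge
type `(n, n)` (Deligne 4.4). [cite: vanGeemen1994HodgeAV, 5.4 and Lemma 5.2 (1)] [cite: Deligne1982HodgeCycles, Prop. 4.4] -/
theorem hasBlochSeedInClass_split_of_hyperbolicBlochSeed {n d : ℕ} (hn : 0 < n) (hd : 0 < d)
    (h : HasHyperbolicBlochSeed n d) : HasBlochSeedInClass n d (splitDiscriminantClass n d) := by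
  obtain ⟨P, ψ₀, e, a, w, hP, hψ, ha, ha0, hhyp, hwW, hwQ, hw0, hseed⟩ := h
  exact fun _ => ⟨P, ψ₀, e, a, w, hP, hψ, ha, ha0, hwW, hwQ, hw0,
    isOfHodgeType_of_mem_weilClassesOf_of_isHyperbolicWeilType hn hd hP hψ e ha ha0 hhyp hwW, hseed,
    hasWeilDiscriminantNondeg_neg_one_pow_of_isHyperbolicWeilType hn hP hd hψ e ha ha0 hhyp⟩

/-- **THE SPLIT CELL'S SEED IS hweil's HYPERBOLIC SEED**: for `n, d ≥ 1`,
`HasBlochSeedInClass n d [(-1)ⁿ] ↔ HasHyperbolicBlochSeed n d` — one open statement, counted once.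
[cite: vanGeemen1994HodgeAV, 5.4] [cite: Deligne1982HodgeCycles, Prop. 4.4] -/
theorem hasBlochSeedInClass_split_iff {n d : ℕ} (hn : 0 < n) (hd : 0 < d) :
    HasBlochSeedInClass n d (splitDiscriminantClass n d) ↔ HasHyperbolicBlochSeed n d :=
  ⟨hasHyperbolicBlochSeed_of_seedInClass_split hn hd, hasBlochSeedInClass_split_of_hyperbolicBlochSeed hn hd⟩

/-- **Seeds in every class ⟹ hweil's door-B′ input `HasSimilarBlochSeeds n d`** (`n, d ≥ 1`): every Weil-type
target `(A, φ)` lies in a right-sign class `δ` (part 5, `weilSign_eq_of_hasWeilDiscriminantNondeg`), and the seed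
member of that class is Weil-similar to it (Landherr, part 8g `isWeilSimilar_of_hasWeilDiscriminantNondeg`).  So the
`HasSimilarBlochSeeds` quantifier "for every target a similar seed anchor" collapses to finitely many seeds per
`(n, d)`: one per norm class of sign `(-1)ⁿ`. [cite: vanGeemen1994HodgeAV, 4.14, Lemma 5.2 (3)–(4) and Thm. 5.3]
[cite: Deligne1982HodgeCycles, proof of Thm. 4.8] -/
theorem hasSimilarBlochSeeds_of_seedInClass {n d : ℕ} (hn : 0 < n) (hd : 0 < d)
    (h : ∀ δ : weilNormResidueGroup d, HasBlochSeedInClass n d δ) : HasSimilarBlochSeeds n d := by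
  intro A φ hA hφ hWA
  obtain ⟨wA, hwA, hwA0, hwAH⟩ := hWA
  have hW : IsWeilType A φ n d := isWeilType_of_weilClass_ne_zero hn hd hA hφ hwA hwA0 hwAH
  obtain ⟨eA, aA, δ, haA, haA0, hδA⟩ := exists_projectiveEmbedding_hasWeilDiscriminantNondeg hn hA hd hφ
  obtain ⟨P, ψ₀, e, a, w, hPdim, hψ, ha, ha0, hwW, hwQ, hw0, hwH, hseed, hδP⟩ :=
    h δ (weilSign_eq_of_hasWeilDiscriminantNondeg hW eA haA haA0 hδA)
  have hWP : IsWeilType P ψ₀ n d := isWeilType_of_weilClass_ne_zero hn hd hPdim hψ hwW hw0 hwH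
  exact ⟨eA, aA, P, ψ₀, e, a, w, haA, haA0, hPdim, hψ, ha, ha0, hwW, hwQ, hw0, hwH, hseed,
    isWeilSimilar_of_hasWeilDiscriminantNondeg hWP hW e ha ha0 eA haA haA0 hδP hδA⟩

/-- **stmt-2524 (`WeilSixfolds`) ⟸ `weilFamilyReach_similar` ∧ `BlochSemiregularSpread 6 3` ∧ a Bloch seed in every
sixfold cell** — hweil's row `weilSixfolds_of_reachSimilar_of_blochSpread_of_similarSeeds` re-indexed by cells
(content only on the NEGATIVE classes `sign δ = -1 = (-1)³`; the node is vacuous elsewhere).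
[cite: Deligne1982HodgeCycles, proof of Thm. 4.8] [cite: Bloch1972Semiregularity, Thm. (7.4) and Remark (7.5)] -/
theorem weilSixfolds_of_reachSimilar_of_blochSpread_of_seedSixfoldCells (hF : weilFamilyReach_similar)
    (hB : BlochSemiregularSpread (2 * 3) 3)
    (hS : ∀ d : ℕ, 0 < d → ∀ δ : weilNormResidueGroup d, HasBlochSeedInClass 3 d δ) :
    Theses.SevenfoldWeilCensus.WeilSixfolds :=
  WeilTypeLadder.weilSixfolds_of_reachSimilar_of_blochSpread_of_similarSeeds hF hB fun d hd =>
    hasSimilarBlochSeeds_of_seedInClass (by norm_num) hd (hS d hd)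

/-! ### §4 Closed forms and the floor -/

/-- **`HasBlochSeedFourfoldCells`** (N81, closed `∀`-form; design input): a Bloch seed — an integral
Bloch-semiregular lci SURFACE carrying `q·h_K² + w` — on one member of every positive non-split cell `(2, d, δ)` with
`d` squarefree, `d ≠ 1, 3` (the fourfold cells not covered by Markman 2023 / Schoen / Koike–van Geemen in the tree's
dimension-`≤ 5` floor). [cite: Bloch1972Semiregularity, Remark (7.5)] [cite: MoonenZarhin1999, Thm. 0.1] -/
@[conjecture] def HasBlochSeedFourfoldCells : Prop :=
  ∀ d : ℕ, 0 < d → Squarefree d → d ≠ 1 → d ≠ 3 → ∀ δ : weilNormResidueGroup d,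
    δ ≠ splitDiscriminantClass 2 d → HasBlochSeedInClass 2 d δ

/-- **`HasBlochSeedAllCells`** (N82, closed `∀`-form; design input): a Bloch seed in every cell `(n, d, δ)`,
`n, d ≥ 1`. [cite: Bloch1972Semiregularity, Remark (7.5)] -/
@[conjecture] def HasBlochSeedAllCells : Prop :=
  ∀ n : ℕ, 0 < n → ∀ d : ℕ, 0 < d → ∀ δ : weilNormResidueGroup d, HasBlochSeedInClass n d δ

/-- N82 ⟹ N81 (specialisation). [folklore] -/
theorem hasBlochSeedFourfoldCells_of_allCells (h : HasBlochSeedAllCells) : HasBlochSeedFourfoldCells :=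
  fun d hd _ _ _ δ _ => h 2 (by norm_num) d hd δ

/-- **N81 ∧ `BlochSemiregularSpread 4 2` ⟹ N79** (`HasLocallyAlgebraicWeilAnchorFourfoldCells`).
[cite: Bloch1972Semiregularity, Thm. (7.4)] [cite: BuchweitzFlenner2003, Thm. 5.2] -/
theorem hasLocallyAlgebraicWeilAnchorFourfoldCells_of_blochSpread_of_seeds (hB : BlochSemiregularSpread (2 * 2) 2)
    (hS : HasBlochSeedFourfoldCells) : HasLocallyAlgebraicWeilAnchorFourfoldCells :=
  fun d hd hsq h1 h3 δ hδ => hasLocallyAlgebraicWeilAnchorInClass_of_blochSpread_of_seedInClass hB (hS d hd hsq h1 h3 δ hδ)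

/-- **N82 ∧ (`∀ n ≥ 1`, `BlochSemiregularSpread (2n) n`) ⟹ N78** (`HasLocallyAlgebraicWeilAnchorAllCells`).
[cite: Bloch1972Semiregularity, Thm. (7.4)] [cite: BuchweitzFlenner2003, Thm. 5.2] -/
theorem hasLocallyAlgebraicWeilAnchorAllCells_of_blochSpread_of_seeds
    (hB : ∀ n : ℕ, 0 < n → BlochSemiregularSpread (2 * n) n) (hS : HasBlochSeedAllCells) :
    HasLocallyAlgebraicWeilAnchorAllCells :=
  fun n hn d hd δ => hasLocallyAlgebraicWeilAnchorInClass_of_blochSpread_of_seedInClass (hB n hn) (hS n hn d hd δ)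

/-- **THE FLOOR through door B fed by seeds.** `HC` for every complex abelian variety of dimension `≤ 5` from the
four refereed print facts (Moonen–Zarhin 1999, Koike 2004, Schoen 1998, Markman 2023), Deligne's reach-by-similitude
`weilFamilyReach_similar`, Bloch's theorem at `(4, 2)` (`BlochSemiregularSpread 4 2`, refereed), and ONE integral
Bloch-semiregular lci surface carrying `q·h_K² + w` on one member of each positive non-split squarefree-`d` fourfold
cell (`HasBlochSeedFourfoldCells`). [cite: MoonenZarhin1999, Thm. 0.1] [cite: Bloch1972Semiregularity, Thm. (7.4)]
[cite: Deligne1982HodgeCycles, proof of Thm. 4.8] [cite: vanGeemen1994HodgeAV, (5.4.1) and Thm. 6.12] -/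
theorem hcUpToDim_five_of_refereed_of_reachSimilar_of_blochSpread_of_fourfoldSeeds
    (hred : MoonenZarhin1999_hodgeClasses_abelian_dim_le_five_of_weilClassesFourfolds)
    (hK : Koike2004_weilClasses_algebraic_hyperbolicSixfold_one)
    (hS : Schoen1998_weilClasses_algebraic_hyperbolicSixfold_three)
    (hM23 : Markman2023_weilClasses_algebraic_discOneWeilFourfold)
    (hF : weilFamilyReach_similar) (hB : BlochSemiregularSpread (2 * 2) 2) (hP : HasBlochSeedFourfoldCells) :
    ClassTargets.HCUpToDim 5 :=
  hcUpToDim_five_of_refereed_of_reachSimilar_of_anchorFourfoldCells hred hK hS hM23 hF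
    (hasLocallyAlgebraicWeilAnchorFourfoldCells_of_blochSpread_of_seeds hB hP)

/-- **`WeilClassesByComponent` ⟸ `weilFamilyReach_similar` ∧ Bloch at every `(2n, n)` ∧ N82.**
[cite: Deligne1982HodgeCycles, proof of Thm. 4.8] [cite: Bloch1972Semiregularity, Thm. (7.4)] -/
theorem weilClassesByComponent_of_reachSimilar_of_blochSpread_of_seedAllCells (hF : weilFamilyReach_similar)
    (hB : ∀ n : ℕ, 0 < n → BlochSemiregularSpread (2 * n) n) (hS : HasBlochSeedAllCells) :
    WeilClassesByComponent :=
  weilClassesByComponent_of_reachSimilar_of_anchorAllCells hF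
    (hasLocallyAlgebraicWeilAnchorAllCells_of_blochSpread_of_seeds hB hS)

/-! ### §5 Necessity: a seed already makes the class algebraic ON THE ANCHOR (unconditionally) -/

/-- **Fulton 19.1.1 at a seed**: a Bloch seed for `(h, w)` on `P` supports `q·hⁿ + w` on the closed subset `Z ⊂ P`
of codimension `≥ n`, so `q·hⁿ + w ∈ algebraicClasses P n` (`iSup_classesSupportedOn_le_algebraicClasses`). No
semiregularity, no integrality and no deformation theory is used. [cite: Fulton1998, Lemma 19.1.1] -/
theorem exists_smul_cupPowTwo_add_mem_algebraicClasses_of_blochSeedAt {n : ℕ} {P : AbelianVariety ℂ}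
    {h : complexBetti P.X 2} {w : complexBetti P.X (2 * n)} (hS : HasBlochSeedAt n P h w) :
    ∃ q : ℚ, ((q : ℚ) : ℂ) • cupPowTwo h n + w ∈ algebraicClasses P.X n := by
  obtain ⟨Z, i, q, hci, -, -, hcod, -, hsupp⟩ := hS
  refine ⟨q, ?_⟩
  have hle : ⨆ _j : PUnit.{1}, classesSupportedOn P.X (Set.range i.base) (2 * n) ≤ algebraicClasses P.X n :=
    iSup_classesSupportedOn_le_algebraicClasses (fun _ => i.isClosedEmbedding.isClosed_range) (fun _ => hcod)
  exact hle (Submodule.mem_iSup_of_mem PUnit.unit hsupp)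

/-- **A seed makes `w` ALGEBRAIC ON THE ANCHOR** (`n ≥ 1`, `h` rational `(1,1)`): `q·hⁿ + w` is algebraic
(previous lemma) and `hⁿ` is algebraic on the abelian variety `P` (Lefschetz `(1,1)` + Kleiman,
`lefschetzOneOne_rational_holds`, `cupPowTwo_mem_algebraicClasses_abelian`). [cite: Fulton1998, Lemma 19.1.1]
[cite: VoisinHodgeI2002, Thm. 11.30] -/
theorem mem_algebraicClasses_of_blochSeedAt {n : ℕ} (hn : 0 < n) {P : AbelianVariety ℂ} {m : ℕ} (hP : P.dim = m)
    {h : complexBetti P.X 2} (hhQ : IsRationalClass h) (hhH : IsOfHodgeType m P.X 2 1 1 h)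
    {w : complexBetti P.X (2 * n)} (hS : HasBlochSeedAt n P h w) : w ∈ algebraicClasses P.X n := by
  obtain ⟨q, hq⟩ := exists_smul_cupPowTwo_add_mem_algebraicClasses_of_blochSeedAt hS
  have hh1 : h ∈ algebraicClasses P.X 1 :=
    lefschetzOneOne_rational_holds (isSmoothProjective_of_dim_eq' hP) _ hhQ hhH
  obtain ⟨k, rfl⟩ : ∃ k, n = k + 1 := ⟨n - 1, by omega⟩
  have hhn : cupPowTwo h (k + 1) ∈ algebraicClasses P.X (k + 1) := cupPowTwo_mem_algebraicClasses_abelian P hh1 k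
  have h' := Submodule.sub_mem _ hq (Submodule.smul_mem _ (((q : ℚ) : ℂ)) hhn)
  rwa [add_sub_cancel_left] at h'

/-- **What a seed member must be** (necessity, `n, d ≥ 1`, unconditionally): if the realisable cell `(n, d, δ)` has
a seed member then it contains a polarized member `(P, ψ₀, h_K)` of class `δ` ALL of whose Weil classes are
algebraic (the seeded class `w ≠ 0` is algebraic on `P`, §5, at the rational `(1,1)` class `h_K`; one class
suffices, `weilClassesOf_le_algebraicClasses_iff_exists_ne_zero_of_dim_eq`).  This first layer is met by every CM
member of the cell (part 8b `weilClassesComponent_holds_at_cmAnchor`); the content of N80 is the integral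
Bloch-semiregular SUPPORT. [cite: Fulton1998, Lemma 19.1.1] [cite: vanGeemen1994HodgeAV, Lemma 5.2 (6) and Thm. 6.12] -/
theorem exists_member_weilClasses_algebraic_of_seedInClass {n d : ℕ} (hn : 0 < n) (hd : 0 < d)
    {δ : weilNormResidueGroup d} (hA : HasBlochSeedInClass n d δ) (hδ : weilSign d δ = (-1) ^ n) :
    ∃ (P : AbelianVariety ℂ) (ψ₀ : P ⟶ P) (e : ProjectiveEmbedding P.X) (a : complexBetti (projectiveSpace e.n ℂ) 2),
      IsWeilType P ψ₀ n d ∧ IsRationalClass a ∧ a ≠ 0 ∧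
      HasWeilDiscriminantNondeg P ψ₀ n d
        ((d : ℂ) • complexBetti.map e.ι 2 a + complexBetti.map ψ₀.hom.hom.hom 2 (complexBetti.map e.ι 2 a)) δ ∧
      weilClassesOf P ψ₀ n d ≤ algebraicClasses P.X n := by
  obtain ⟨P, ψ₀, e, a, w, hP, hψ, ha, ha0, hwW, hwQ, hw0, hwH, hseed, hδP⟩ := hA hδ
  refine ⟨P, ψ₀, e, a, isWeilType_of_weilClass_ne_zero hn hd hP hψ hwW hw0 hwH, ha, ha0, hδP, ?_⟩
  have hP' : P.dim = (2 * n - 1) + 1 := by omega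
  have hH := isOfHodgeType_one_one_ksymm hP' hd ψ₀ e ha ha0
  exact (weilClassesOf_le_algebraicClasses_iff_exists_ne_zero_of_dim_eq abelianVarietyCohomologyExteriorH1_holds
    hP hn hd hψ).2 ⟨w, hwW, mem_algebraicClasses_of_blochSeedAt hn hP' (isRationalClass_ksymm d ψ₀ e ha) hH hseed, hw0⟩

end Summit.HodgeConjecture.HodgeConjecture.Ring2.AbelianAll

end
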